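import Mathlib
import HarnessLib

/-!
# SoloInformed — line derivatives from one-variable derivatives; `Re/Im (G∘h · D)` (toolkit for (HT))

File I2b₁₀ of the (HT) step.  `soloInformed_kzGreen_line` asks for *line derivatives*
`HasLineDerivAt ℝ P (Pₜ z) z (Pi.single i 1)` of the real coefficients of a pulled-back form.  This
file provides the two adapters used to produce them from honest one-variable calculus:

* `soloInformed_hasLineDerivAt_of_update` — a derivative of `u ↦ f (update z i u)` at `u = z i` is
  the line derivative of `f` at `z` along `eᵢ`;
* `soloInformed_hasDerivAt_re_comp_mul` / `_im_` — for `G : ℂ → ℂ` complex-differentiable at `h t`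
  and real curves `h, D : ℝ → ℂ` differentiable at `t`, the real functions `Re/Im (G(h u) · D u)`
  are differentiable at `t` with derivative `Re/Im (G′ h′ D + G D′)` — the shape of the coefficients
  `P = Re(G(h) ∂ₛh)`, `Q = Re(G(h) ∂ₜh)` of `G dw` pulled back along a Coons patch `h`.
-/

noncomputable section

namespace Summit.KontsevichZagierPeriods.KontsevichZagierPeriods.Theorems

open Set

/-- `z + τ·eᵢ = update z i (z i + τ)`. -/
theorem soloInformed_add_smul_single_eq_update {m : ℕ} (z : Fin m → ℝ) (i : Fin m) (τ : ℝ) :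
    z + τ • (Pi.single i 1 : Fin m → ℝ) = Function.update z i (z i + τ) := by
  ext j
  by_cases hj : j = i
  · subst hj
    simp
  · simp [hj]

/-- **Line derivative along `eᵢ` from the one-variable derivative in the `i`-th slot.** -/
theorem soloInformed_hasLineDerivAt_of_update {m : ℕ} {f : (Fin m → ℝ) → ℝ} {z : Fin m → ℝ}
    {i : Fin m} {f' : ℝ} (h : HasDerivAt (fun u => f (Function.update z i u)) f' (z i)) :
    HasLineDerivAt ℝ f f' z (Pi.single i 1) := by
  show HasDerivAt (fun τ : ℝ => f (z + τ • (Pi.single i 1 : Fin m → ℝ))) f' 0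
  have h0 : HasDerivAt (fun u => f (Function.update z i u)) f' (z i + 0) := by
    rw [add_zero]; exact h
  have h1 := HasDerivAt.comp_const_add (z i) 0 h0
  refine h1.congr_of_eventuallyEq (Filter.Eventually.of_forall fun τ => ?_)
  show f (z + τ • (Pi.single i 1 : Fin m → ℝ)) = f (Function.update z i (z i + τ))
  rw [soloInformed_add_smul_single_eq_update]

/-- **Product–chain rule, complex form.**  `d/dt [G(h t) · D t] = G′(h t) h′ D t + G(h t) D′`. -/
theorem soloInformed_hasDerivAt_comp_mul {G : ℂ → ℂ} {G' : ℂ} {h D : ℝ → ℂ} {h' D' : ℂ} {t : ℝ}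
    (hG : HasDerivAt G G' (h t)) (hh : HasDerivAt h h' t) (hD : HasDerivAt D D' t) :
    HasDerivAt (fun u => G (h u) * D u) (G' * h' * D t + G (h t) * D') t := by
  have h1 : HasDerivAt (fun u => G (h u)) (G' * h') t := hG.comp t hh
  exact h1.mul hD

/-- **Real part** of the product–chain rule. -/
theorem soloInformed_hasDerivAt_re_comp_mul {G : ℂ → ℂ} {G' : ℂ} {h D : ℝ → ℂ} {h' D' : ℂ}
    {t : ℝ} (hG : HasDerivAt G G' (h t)) (hh : HasDerivAt h h' t) (hD : HasDerivAt D D' t) :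
    HasDerivAt (fun u => (G (h u) * D u).re) (G' * h' * D t + G (h t) * D').re t := by
  have h1 := soloInformed_hasDerivAt_comp_mul hG hh hD
  have h2 := Complex.reCLM.hasFDerivAt.comp_hasDerivAt t h1
  rw [Complex.reCLM_apply] at h2
  exact h2.congr_of_eventuallyEq (Filter.Eventually.of_forall fun u => by
    simp only [Function.comp_apply, Complex.reCLM_apply])

/-- **Imaginary part** of the product–chain rule. -/
theorem soloInformed_hasDerivAt_im_comp_mul {G : ℂ → ℂ} {G' : ℂ} {h D : ℝ → ℂ} {h' D' : ℂ}
    {t : ℝ} (hG : HasDerivAt G G' (h t)) (hh : HasDerivAt h h' t) (hD : HasDerivAt D D' t) :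
    HasDerivAt (fun u => (G (h u) * D u).im) (G' * h' * D t + G (h t) * D').im t := by
  have h1 := soloInformed_hasDerivAt_comp_mul hG hh hD
  have h2 := Complex.imCLM.hasFDerivAt.comp_hasDerivAt t h1
  rw [Complex.imCLM_apply] at h2
  exact h2.congr_of_eventuallyEq (Filter.Eventually.of_forall fun u => by
    simp only [Function.comp_apply, Complex.imCLM_apply])

/-- **Continuity of `G ∘ h · D` type coefficients** on a set, from continuity of the pieces. -/
theorem soloInformed_continuousOn_re_comp_mul {X : Type*} [TopologicalSpace X] {G : ℂ → ℂ}
    {B : Set ℂ} {h D : X → ℂ} {W : Set X} (hG : ContinuousOn G B) (hh : ContinuousOn h W)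
    (hD : ContinuousOn D W) (hB : MapsTo h W B) :
    ContinuousOn (fun x => (G (h x) * D x).re) W :=
  Complex.continuous_re.comp_continuousOn ((hG.comp hh hB).mul hD)

/-- Imaginary-part version of `soloInformed_continuousOn_re_comp_mul`. -/
theorem soloInformed_continuousOn_im_comp_mul {X : Type*} [TopologicalSpace X] {G : ℂ → ℂ}
    {B : Set ℂ} {h D : X → ℂ} {W : Set X} (hG : ContinuousOn G B) (hh : ContinuousOn h W)
    (hD : ContinuousOn D W) (hB : MapsTo h W B) :
    ContinuousOn (fun x => (G (h x) * D x).im) W :=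
  Complex.continuous_im.comp_continuousOn ((hG.comp hh hB).mul hD)

end Summit.KontsevichZagierPeriods.KontsevichZagierPeriods.Theorems
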